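import Mathlib
import Literature.Computability.AlgebraicComplexity.EquivariantDC
import Literature.Computability.AlgebraicComplexity.DetReprEquivalent

/-!
# `OrbitDimensionBound` (stmt-ValiantsHypothesis-16133), line `sign_covering`, stub `stub_signLinearise` —
part 2a: algebra of exact lifts and polynomial tools

An EXACT LIFT of a substitution `γ ∈ GL(σ)` to an `m × m` matrix of polynomials `B` is here a pair
`(g, h) ∈ GL_m × GL_m` with `B(γ · x) = g⁻¹ · B(x) · h` (this convention makes lifts compose covariantly).
§1: lifts compose (`lift_mul`), invert (`lift_inv`), and a lift of `γ = 1` is a pair with `g · B = B · h`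
(`lift_one_iff`); such intertwining pairs are closed under sums, scalars, products and polynomial expressions
(`intertwine_*`).  §2: `p(N)` commutes with what commutes with `N`, `p(N) c = p(0) c` if `N c = 0`, and the Hensel
lift of `(1 + X)^{-1/2}`: for every `K` there are `p, q ∈ ℂ[X]` with `p² (1 + X) = 1 + X^{K+1} q`, `p(0) = 1`
(`exists_sq_mul_one_add_X`), whence an inverse square root of `G²` as a polynomial in the nilpotent `G² - 1`
(`exists_inv_sqrt`).

No new definitions; helper file for `Theorems/FreeSubtorusOrbitDimensionBoundStubSignLinearise.lean`
(`--supports stmt-ValiantsHypothesis-16133`).  Nothing here moves the crux `OrbitDimensionBound`, the route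
`FreeSubtorus` or VP ≠ VNP.

## References
* [LandsbergRessayre2017] J. M. Landsberg, N. Ressayre, *Permanent v. determinant: an exponential lower bound
  assuming symmetry and a potential path towards Valiant's conjecture*, Differential Geom. Appl. 55 (2017),
  Def. 1.3, §6.
-/

set_option linter.dupNamespace false

namespace Summit.ValiantsHypothesis.ValiantsHypothesis.Theorems.FreeSubtorusOrbitDimensionBound.SignCovering

open Matrix MvPolynomial
open Literature.Computability.AlgebraicComplexity

variable {σ : Type*} [Fintype σ] [DecidableEq σ] {m : ℕ}

/-! ### §1 Algebra of exact lifts `B(γ·x) = g⁻¹ · B · h` -/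

section LiftAlgebra

variable (B : Matrix (Fin m) (Fin m) (MvPolynomial σ ℂ))

omit [Fintype σ] [DecidableEq σ] in
/-- `u · u⁻¹ = 1` after mapping the entries into the polynomial ring. [folklore] -/
theorem map_C_val_mul_val_inv (u : GL (Fin m) ℂ) :
    ((u : Matrix (Fin m) (Fin m) ℂ).map C : Matrix (Fin m) (Fin m) (MvPolynomial σ ℂ)) *
      ((u⁻¹ : GL (Fin m) ℂ) : Matrix (Fin m) (Fin m) ℂ).map C = 1 := by
  rw [← Matrix.map_mul, ← Units.val_mul, mul_inv_cancel, Units.val_one, Matrix.map_one C C_0 C_1]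

omit [Fintype σ] [DecidableEq σ] in
/-- `u⁻¹ · u = 1` after mapping the entries into the polynomial ring. [folklore] -/
theorem map_C_val_inv_mul_val (u : GL (Fin m) ℂ) :
    (((u⁻¹ : GL (Fin m) ℂ) : Matrix (Fin m) (Fin m) ℂ).map C : Matrix (Fin m) (Fin m) (MvPolynomial σ ℂ)) *
      (u : Matrix (Fin m) (Fin m) ℂ).map C = 1 := by
  rw [← Matrix.map_mul, ← Units.val_mul, inv_mul_cancel, Units.val_one, Matrix.map_one C C_0 C_1]

/-- Exact lifts compose: lifts of `γ₁`, `γ₂` give a lift of `γ₁ γ₂` (componentwise product). [folklore] -/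
theorem lift_mul {γ₁ γ₂ : GL σ ℂ} {g₁ h₁ g₂ h₂ : GL (Fin m) ℂ}
    (e₁ : Matrix.linSubstEntries γ₁ B = ((g₁⁻¹ : GL (Fin m) ℂ) : Matrix (Fin m) (Fin m) ℂ).map C * B *
      ((h₁ : GL (Fin m) ℂ) : Matrix (Fin m) (Fin m) ℂ).map C)
    (e₂ : Matrix.linSubstEntries γ₂ B = ((g₂⁻¹ : GL (Fin m) ℂ) : Matrix (Fin m) (Fin m) ℂ).map C * B *
      ((h₂ : GL (Fin m) ℂ) : Matrix (Fin m) (Fin m) ℂ).map C) :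
    Matrix.linSubstEntries (γ₁ * γ₂) B = (((g₁ * g₂)⁻¹ : GL (Fin m) ℂ) : Matrix (Fin m) (Fin m) ℂ).map C * B *
      ((h₁ * h₂ : GL (Fin m) ℂ) : Matrix (Fin m) (Fin m) ℂ).map C := by
  rw [← Matrix.linSubstEntries_linSubstEntries, e₂, Matrix.linSubstEntries_mul, Matrix.linSubstEntries_mul,
    Matrix.linSubstEntries_map_C, Matrix.linSubstEntries_map_C, e₁, _root_.mul_inv_rev, Units.val_mul, Units.val_mul,
    Matrix.map_mul, Matrix.map_mul]
  simp only [Matrix.mul_assoc]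

/-- Exact lifts invert. [folklore] -/
theorem lift_inv {γ : GL σ ℂ} {g h : GL (Fin m) ℂ}
    (e : Matrix.linSubstEntries γ B = ((g⁻¹ : GL (Fin m) ℂ) : Matrix (Fin m) (Fin m) ℂ).map C * B *
      ((h : GL (Fin m) ℂ) : Matrix (Fin m) (Fin m) ℂ).map C) :
    Matrix.linSubstEntries γ⁻¹ B = ((g⁻¹⁻¹ : GL (Fin m) ℂ) : Matrix (Fin m) (Fin m) ℂ).map C * B *
      ((h⁻¹ : GL (Fin m) ℂ) : Matrix (Fin m) (Fin m) ℂ).map C := by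
  have key : B = ((g⁻¹ : GL (Fin m) ℂ) : Matrix (Fin m) (Fin m) ℂ).map C * Matrix.linSubstEntries γ⁻¹ B *
      ((h : GL (Fin m) ℂ) : Matrix (Fin m) (Fin m) ℂ).map C := by
    have := congrArg (Matrix.linSubstEntries γ⁻¹) e
    rwa [Matrix.linSubstEntries_inv_linSubstEntries, Matrix.linSubstEntries_mul, Matrix.linSubstEntries_mul,
      Matrix.linSubstEntries_map_C, Matrix.linSubstEntries_map_C] at this
  rw [inv_inv]
  calc Matrix.linSubstEntries γ⁻¹ B
      = ((g : Matrix (Fin m) (Fin m) ℂ).map C * ((g⁻¹ : GL (Fin m) ℂ) : Matrix (Fin m) (Fin m) ℂ).map C) *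
          Matrix.linSubstEntries γ⁻¹ B * (((h : GL (Fin m) ℂ) : Matrix (Fin m) (Fin m) ℂ).map C *
          ((h⁻¹ : GL (Fin m) ℂ) : Matrix (Fin m) (Fin m) ℂ).map C) := by
        rw [map_C_val_mul_val_inv, map_C_val_mul_val_inv, Matrix.one_mul, Matrix.mul_one]
    _ = (g : Matrix (Fin m) (Fin m) ℂ).map C * (((g⁻¹ : GL (Fin m) ℂ) : Matrix (Fin m) (Fin m) ℂ).map C *
          Matrix.linSubstEntries γ⁻¹ B * ((h : GL (Fin m) ℂ) : Matrix (Fin m) (Fin m) ℂ).map C) *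
          ((h⁻¹ : GL (Fin m) ℂ) : Matrix (Fin m) (Fin m) ℂ).map C := by
        simp only [Matrix.mul_assoc]
    _ = (g : Matrix (Fin m) (Fin m) ℂ).map C * B * ((h⁻¹ : GL (Fin m) ℂ) : Matrix (Fin m) (Fin m) ℂ).map C := by
        rw [← key]

/-- An exact lift of `γ = 1` is a pair `(g, h)` with `g · B = B · h`. [folklore] -/
theorem lift_one_iff {g h : GL (Fin m) ℂ} :
    Matrix.linSubstEntries (1 : GL σ ℂ) B = ((g⁻¹ : GL (Fin m) ℂ) : Matrix (Fin m) (Fin m) ℂ).map C * B *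
      ((h : GL (Fin m) ℂ) : Matrix (Fin m) (Fin m) ℂ).map C ↔
    (g : Matrix (Fin m) (Fin m) ℂ).map C * B = B * (h : Matrix (Fin m) (Fin m) ℂ).map C := by
  rw [Matrix.linSubstEntries_one]
  constructor
  · intro e
    calc (g : Matrix (Fin m) (Fin m) ℂ).map C * B
        = (g : Matrix (Fin m) (Fin m) ℂ).map C * (((g⁻¹ : GL (Fin m) ℂ) : Matrix (Fin m) (Fin m) ℂ).map C * B *
            ((h : GL (Fin m) ℂ) : Matrix (Fin m) (Fin m) ℂ).map C) := by rw [← e]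
      _ = ((g : Matrix (Fin m) (Fin m) ℂ).map C * ((g⁻¹ : GL (Fin m) ℂ) : Matrix (Fin m) (Fin m) ℂ).map C) * B *
            ((h : GL (Fin m) ℂ) : Matrix (Fin m) (Fin m) ℂ).map C := by simp only [Matrix.mul_assoc]
      _ = B * (h : Matrix (Fin m) (Fin m) ℂ).map C := by rw [map_C_val_mul_val_inv, Matrix.one_mul]
  · intro e
    calc B = (((g⁻¹ : GL (Fin m) ℂ) : Matrix (Fin m) (Fin m) ℂ).map C * (g : Matrix (Fin m) (Fin m) ℂ).map C) * B := by
          rw [map_C_val_inv_mul_val, Matrix.one_mul]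
      _ = ((g⁻¹ : GL (Fin m) ℂ) : Matrix (Fin m) (Fin m) ℂ).map C * ((g : Matrix (Fin m) (Fin m) ℂ).map C * B) := by
          rw [Matrix.mul_assoc]
      _ = ((g⁻¹ : GL (Fin m) ℂ) : Matrix (Fin m) (Fin m) ℂ).map C * B * (h : Matrix (Fin m) (Fin m) ℂ).map C := by
          rw [e, Matrix.mul_assoc]

omit [Fintype σ] [DecidableEq σ] in
/-- `(a • M).map C = C a • M.map C`. [folklore] -/
theorem map_C_smul (a : ℂ) (M : Matrix (Fin m) (Fin m) ℂ) :
    ((a • M).map C : Matrix (Fin m) (Fin m) (MvPolynomial σ ℂ)) = (C a : MvPolynomial σ ℂ) • M.map C := by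
  ext i j
  simp [Matrix.map_apply]

omit [Fintype σ] [DecidableEq σ] in
/-- The intertwiners `X · B = B · Y` are closed under addition. [folklore] -/
theorem intertwine_add {X Y X' Y' : Matrix (Fin m) (Fin m) ℂ}
    (h : X.map C * B = B * Y.map C) (h' : X'.map C * B = B * Y'.map C) :
    (X + X').map C * B = B * (Y + Y').map C := by
  rw [Matrix.map_add C (map_add C), Matrix.map_add C (map_add C), Matrix.add_mul, Matrix.mul_add, h, h']

omit [Fintype σ] [DecidableEq σ] in
/-- … under scalars. [folklore] -/
theorem intertwine_smul {X Y : Matrix (Fin m) (Fin m) ℂ} (h : X.map C * B = B * Y.map C) (a : ℂ) :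
    (a • X).map C * B = B * (a • Y).map C := by
  rw [map_C_smul, map_C_smul, Matrix.smul_mul, Matrix.mul_smul, h]

omit [Fintype σ] [DecidableEq σ] in
/-- … under products. [folklore] -/
theorem intertwine_mul {X Y X' Y' : Matrix (Fin m) (Fin m) ℂ}
    (h : X.map C * B = B * Y.map C) (h' : X'.map C * B = B * Y'.map C) :
    (X * X').map C * B = B * (Y * Y').map C := by
  rw [Matrix.map_mul, Matrix.map_mul, Matrix.mul_assoc, h', ← Matrix.mul_assoc, h, Matrix.mul_assoc]

omit [Fintype σ] [DecidableEq σ] in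
/-- … contain `1`. [folklore] -/
theorem intertwine_one : (1 : Matrix (Fin m) (Fin m) ℂ).map C * B = B * (1 : Matrix (Fin m) (Fin m) ℂ).map C := by
  rw [Matrix.map_one C C_0 C_1, Matrix.one_mul, Matrix.mul_one]

omit [Fintype σ] [DecidableEq σ] in
/-- … under subtraction. [folklore] -/
theorem intertwine_sub {X Y X' Y' : Matrix (Fin m) (Fin m) ℂ}
    (h : X.map C * B = B * Y.map C) (h' : X'.map C * B = B * Y'.map C) :
    (X - X').map C * B = B * (Y - Y').map C := by
  rw [Matrix.map_sub C (map_sub C), Matrix.map_sub C (map_sub C), Matrix.sub_mul, Matrix.mul_sub, h, h']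

omit [Fintype σ] [DecidableEq σ] in
/-- `(p · X)(N) = p(N) · N`. [folklore] -/
theorem aeval_mul_X_eq {A : Type*} [Ring A] [Algebra ℂ A] (N : A) {p : Polynomial ℂ} :
    Polynomial.aeval N (p * Polynomial.X) = Polynomial.aeval N p * N := by
  rw [map_mul, Polynomial.aeval_X]

omit [Fintype σ] [DecidableEq σ] in
/-- … and hence under polynomial expressions. [folklore] -/
theorem intertwine_aeval {X Y : Matrix (Fin m) (Fin m) ℂ} (h : X.map C * B = B * Y.map C) (p : Polynomial ℂ) :
    (Polynomial.aeval X p).map C * B = B * (Polynomial.aeval Y p).map C := by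
  induction p using Polynomial.induction_on with
  | C a =>
    rw [Polynomial.aeval_C, Polynomial.aeval_C, Algebra.algebraMap_eq_smul_one]
    exact intertwine_smul B (intertwine_one B) a
  | add p q hp hq =>
    rw [map_add, map_add]
    exact intertwine_add B hp hq
  | monomial n a hn =>
    have e : Polynomial.C a * Polynomial.X ^ (n + 1) = (Polynomial.C a * Polynomial.X ^ n) * Polynomial.X := by
      rw [pow_succ, mul_assoc]
    rw [e, aeval_mul_X_eq X, aeval_mul_X_eq Y]
    exact intertwine_mul B hn h

end LiftAlgebra

/-! ### §2 Polynomial tools: commuting with `p(N)`, `p(N) c = p(0) c`, and `√(1+X)⁻¹` modulo `X^K` -/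

section PolyTools

/-- Anything commuting with `N` commutes with `p(N)`. [folklore] -/
theorem commute_aeval_of_commute {A : Type*} [Ring A] [Algebra ℂ A] {x N : A} (h : Commute x N)
    (p : Polynomial ℂ) : Commute x (Polynomial.aeval N p) := by
  induction p using Polynomial.induction_on with
  | C a =>
    rw [Polynomial.aeval_C]
    exact Algebra.commute_algebraMap_right a x
  | add p q hp hq =>
    rw [map_add]; exact hp.add_right hq
  | monomial n a _ =>
    rw [map_mul, Polynomial.aeval_C, map_pow, Polynomial.aeval_X]
    exact (Algebra.commute_algebraMap_right a x).mul_right (h.pow_right _)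

/-- If `N c = 0` then `p(N) c = p(0) c`. [folklore] -/
theorem aeval_mulVec_of_mulVec_eq_zero {m : ℕ} {N : Matrix (Fin m) (Fin m) ℂ} {c : Fin m → ℂ}
    (h : N *ᵥ c = 0) (p : Polynomial ℂ) :
    (Polynomial.aeval N p) *ᵥ c = (p.eval 0) • c := by
  induction p using Polynomial.induction_on with
  | C a =>
    rw [Polynomial.aeval_C, Polynomial.eval_C, Algebra.algebraMap_eq_smul_one, Matrix.smul_mulVec,
      Matrix.one_mulVec]
  | add p q hp hq =>
    rw [map_add, Matrix.add_mulVec, hp, hq, Polynomial.eval_add, add_smul]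
  | monomial n a _ =>
    have e : Polynomial.C a * Polynomial.X ^ (n + 1) = (Polynomial.C a * Polynomial.X ^ n) * Polynomial.X := by
      rw [pow_succ, mul_assoc]
    rw [e, aeval_mul_X_eq, ← Matrix.mulVec_mulVec, h, Matrix.mulVec_zero, Polynomial.eval_mul_X, mul_zero,
      zero_smul]

/-- **Hensel lifting of `(1 + X)^{-1/2}`**: for every `K` there are polynomials `p, q ∈ ℂ[X]` with
`p² (1 + X) = 1 + X^{K+1} q` and `p(0) = 1`. [folklore] -/
theorem exists_sq_mul_one_add_X (K : ℕ) :
    ∃ p q : Polynomial ℂ, p * p * (1 + Polynomial.X) = 1 + Polynomial.X ^ (K + 1) * q ∧ p.eval 0 = 1 := by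
  induction K with
  | zero => exact ⟨1, 1, by ring, by simp⟩
  | succ K ih =>
    obtain ⟨p, q, hpq, hp0⟩ := ih
    set b : ℂ := q.eval 0 / 2 with hb
    refine ⟨p - Polynomial.C b * Polynomial.X ^ (K + 1), ?_⟩
    set r : Polynomial ℂ := q - 2 * Polynomial.C b * p * (1 + Polynomial.X) +
      Polynomial.C b * Polynomial.C b * Polynomial.X ^ (K + 1) * (1 + Polynomial.X) with hr
    have hid : (p - Polynomial.C b * Polynomial.X ^ (K + 1)) * (p - Polynomial.C b * Polynomial.X ^ (K + 1)) *
        (1 + Polynomial.X) = 1 + Polynomial.X ^ (K + 1) * r := by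
      rw [hr]; linear_combination hpq
    have hr0 : r.eval 0 = 0 := by
      rw [hr]
      simp only [Polynomial.eval_add, Polynomial.eval_sub, Polynomial.eval_mul, Polynomial.eval_C,
        Polynomial.eval_X, Polynomial.eval_pow, Polynomial.eval_one, Polynomial.eval_ofNat, hp0,
        zero_pow (Nat.succ_ne_zero K)]
      rw [hb]; ring
    have hXr : Polynomial.X ∣ r := by
      rw [Polynomial.X_dvd_iff, Polynomial.coeff_zero_eq_eval_zero]; exact hr0
    obtain ⟨r', hr'⟩ := hXr
    refine ⟨r', ?_, ?_⟩
    · rw [hid, hr', pow_succ]; ring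
    · simp only [Polynomial.eval_sub, Polynomial.eval_mul, Polynomial.eval_C, Polynomial.eval_pow,
        Polynomial.eval_X, zero_pow (Nat.succ_ne_zero K), mul_zero, sub_zero, hp0]

/-- **Inverse square root of a unipotent.**  If `N = G² - 1` satisfies `N^{K+1} = 0`, there is a polynomial
expression `w` in `N` with `w² G² = 1`, `G w = w G`, commuting with everything commuting with `G`, and fixing every
vector killed by `N`. [folklore] -/
theorem exists_inv_sqrt {m : ℕ} (G : Matrix (Fin m) (Fin m) ℂ) (K : ℕ) (hN : (G * G - 1) ^ (K + 1) = 0) :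
    ∃ p : Polynomial ℂ, p.eval 0 = 1 ∧
      Polynomial.aeval (G * G - 1) p * Polynomial.aeval (G * G - 1) p * (G * G) = 1 ∧
      (∀ r : Matrix (Fin m) (Fin m) ℂ, Commute r G → Commute r (Polynomial.aeval (G * G - 1) p)) := by
  obtain ⟨p, q, hpq, hp0⟩ := exists_sq_mul_one_add_X K
  refine ⟨p, hp0, ?_, fun r hr => ?_⟩
  · have := congrArg (Polynomial.aeval (G * G - 1)) hpq
    rw [map_mul, map_mul, map_add, map_one, Polynomial.aeval_X, map_add, map_one, map_mul, map_pow,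
      Polynomial.aeval_X, hN, zero_mul, add_zero, add_sub_cancel] at this
    exact this
  · exact commute_aeval_of_commute ((hr.mul_right hr).sub_right (Commute.one_right r)) p

end PolyTools

end Summit.ValiantsHypothesis.ValiantsHypothesis.Theorems.FreeSubtorusOrbitDimensionBound.SignCovering
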